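/-
Copyright: the b2b-balaban cell (near-miss cell 7), T⁴-continuum fan-out; row NE7b ROUND-2 swarm, seat
t4-ne7b-formalise-leaf-02 gen 4 (row S6g′ instance sub-piece «INST-SUP» of `t4/b2b-balaban-t4-ne7b-p1/LEAVES-NE7b.md`,
leaf-05 gen 2's `INSTANCE-RECIPE.md` §1: the one-block root count).
Released under the licence of the surrounding project.
-/
import Summits.QuantumFields.BalabanUV.T4Continuum.Support.HistoryJoinsSup
import Summits.QuantumFields.BalabanUV.T4Continuum.Support.HistoryMassPlacementLevels

/-!
# History joins, suprema — part 2: THE TORUS ROOT COUNT in the END's currency (row S6g′, instance sub-piece INST-SUP)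

Summits-side support leaf of the T⁴-continuum cell (rung (B)+1 on a FINITE torus only; NOT infinite volume, NOT the
mass gap, NOT the Clay statement; NOT a proof of the spine estimate NE7b).  Row NE7b, route «COUNT»; row S6g′.
[folklore] finite bookkeeping over the lineage's own carriers; nothing is quoted from print, nothing printed is asserted,
no `[cite:]` tag, no `Prop` fact of Bałaban's.

WHAT.  The END's third local law `hNZ : #{y | near u t y s r} ≤ NZ r t s` and its fibre shape `hNZle : NZ r t s ≤ Mρ r·Λ^{t+1−s}`
(`HistoryJoinsBudget.NZP_le_pow`), together with the exponential type `0 ≤ Mρ r ≤ exp(a + d′·r)` (`r ≥ 0`) asked by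
`HistoryJoinsRadius.MρP_le_exp_bsum`, DISCHARGED for the torus touch relations of row S6g′(b) (leaf-10 gen 2's
`HistoryMassPlacementTorus.touchT` ∕ leaf-07 gen 2's `HistoryMassPlacementLevels.touchD`) read at a REAL radius through
part 1's hull `HistoryJoinsSup.nearOfNat`:
* §1 `touchT_mono_radius`; **`nearT n L K := nearOfNat (touchT n L K · · ·)`** (block `u : Fin d → ℕ`, root cell
  `y : TCell d (n·L^K)` of scale `s`, level `t`, radius `r : ℝ`), `nearT_mono` (§2's `hmono` of part 1), `nearT_of_touchT`
  (the witness), `blk L ℓ y` (the level-`ℓ` block of a cell) and **`nearT_of_scale`** (part 1 §2's reading fact `hnearW`: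
  a block in range at level `t ≤ K` is near a scale-`s` cell at its own cyclic sup-distance to the cell's block); **`NZT d L r t s := NTT d L ⌊r⌋₊ t s`**, **`card_nearT_le`** (= `hNZ`, from `card_touchT_le`);
  **`MρT d r := (2⌊r⌋₊ + 1)^d`**, `MρT_nonneg`, **`NZT_le`** (= `hNZle` with `Λ := L^d`, from `NTT_le`), **`MρT_le_exp`**
  (`MρT d r ≤ exp(0 + 2d·r)` for `r ≥ 0`: `2⌊r⌋₊ + 1 ≤ 2r + 1 ≤ e^{2r}`);
* §2 the same AT LEVELS: **`nearD n L K lv`**, `nearD_of_scale`, **`NZD d L lv`**, `card_nearD_le`, **`NZD_le`** (under `LevelFn K lv`, from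
  `NTD_le`) — the currency of the realised pedigrees' zone reading (`ZoneReadingD … lv`).

HONEST SCOPE.  Counting on OUR torus carrier; nothing of print; `BirthShapeNodup` NOT retired; NE7b NOT proved; spine
0∕9.  HONEST DEPENDENCY (cell): continuum YM on T⁴ ⇐ BetaPertH ∧ nine spine estimates (0/9 proved); BetaPertH ⇐ (D1)
∧ (D4) ∧ CAP+tail; G-an2-4 gates asym, D1 and NE2/3/4.  This file changes none of it.
-/

namespace Summit.QuantumFields.BalabanUV.T4Continuum.HistoryJoinsSupTorus

open Finset
open Summit.QuantumFields.BalabanUV.T4Continuum.ZoneTorus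
open Summit.QuantumFields.BalabanUV.T4Continuum.HistoryMassPlacement
open Summit.QuantumFields.BalabanUV.T4Continuum.HistoryZones
open Summit.QuantumFields.BalabanUV.T4Continuum.HistoryJoinsSup

noncomputable section

open scoped Classical

variable {d : ℕ}

/-! ## §1 The torus touch relation at a real radius -/

/-- the torus touch relation is monotone in its integer radius [folklore] -/
theorem touchT_mono_radius {n L K k k' t : ℕ} {a : Fin d → ℕ} {y : TCell d (n * L ^ K)} {s : ℕ} (hk : k ≤ k')
    (h : touchT n L K k t a y s) : touchT n L K k' t a y s :=
  ⟨h.1, h.2.1, h.2.2.1, fun i => (h.2.2.2 i).trans hk⟩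

/-- **THE TORUS NEARNESS AT A REAL RADIUS**: the scale-`s` cell `y` touches the level-`t` block `u` at some integer
radius `k ≤ r`. [folklore] -/
def nearT (n L K : ℕ) : (Fin d → ℕ) → ℕ → TCell d (n * L ^ K) → ℕ → ℝ → Prop :=
  nearOfNat fun k u t y s => touchT n L K k t u y s

/-- `nearT` is monotone in the radius (part 1 §2's `hmono`) [folklore] -/
theorem nearT_mono (n L K : ℕ) (u : Fin d → ℕ) (t : ℕ) (y : TCell d (n * L ^ K)) (s : ℕ) (r r' : ℝ)
    (h : nearT n L K u t y s r) (hr : r ≤ r') : nearT n L K u t y s r' :=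
  nearOfNat_mono _ u t y s r r' h hr

/-- touching at integer radius `k` is being near at real radius `k` (part 1 §2's witness radius) [folklore] -/
theorem nearT_of_touchT {n L K k t : ℕ} {u : Fin d → ℕ} {y : TCell d (n * L ^ K)} {s : ℕ}
    (h : touchT n L K k t u y s) : nearT n L K u t y s (k : ℝ) :=
  nearOfNat_of_touch _ h

/-- the level-`ℓ` BLOCK OF A CELL: coordinatewise integer division by `L^ℓ` [folklore] -/
def blk (L ℓ : ℕ) {N : ℕ} (y : TCell d N) : Fin d → ℕ := fun i => (y i).val / L ^ ℓ

/-- **THE READING FACT `hnearW` ON THE TORUS**: a block `u` in range at a level `t ≤ K` is near a scale-`s` cell `y` at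
its own witness radius, the cyclic sup-distance `cdist (n·L^{K−t}) u (blk L t y)` (part 3's `δT`). [folklore] -/
theorem nearT_of_scale {n L K t s : ℕ} {u : Fin d → ℕ} {y : TCell d (n * L ^ K)} (htK : t ≤ K)
    (hy : IsScale L s y) (hu : ∀ i, u i < n * L ^ (K - t)) :
    nearT n L K u t y s ((cdist (n * L ^ (K - t)) u (blk L t y) : ℕ) : ℝ) :=
  nearOfNat_of_touch _ (show touchT n L K _ t u y s from
    ⟨htK, hy, hu, fun i => (cdist_le_iff (u := u) (v := blk L t y)).1 le_rfl i⟩)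

/-- **THE ONE-BLOCK ROOT COUNT** in the END's currency: `NTT` at the integer part of the radius. [folklore] -/
def NZT (d L : ℕ) (r : ℝ) (t s : ℕ) : ℕ := NTT d L ⌊r⌋₊ t s

/-- **`hNZ` ON THE TORUS**: `#{y | nearT n L K u t y s r} ≤ NZT d L r t s` (`card_touchT_le`, uniform in the block).
[folklore] -/
theorem card_nearT_le (n : ℕ) {L : ℕ} (hL : 1 ≤ L) (K : ℕ) (u : Fin d → ℕ) (t s : ℕ) (r : ℝ) :
    ((univ : Finset (TCell d (n * L ^ K))).filter fun y => nearT n L K u t y s r).card ≤ NZT d L r t s :=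
  card_nearOfNat_le (fun k u t y s => touchT n L K k t u y s) (fun _ _ _ _ _ _ hk h => touchT_mono_radius hk h)
    (fun k t s => NTT d L k t s) (fun k u t s => card_touchT_le n hL K k t u s) u t s r

/-- **THE RADIUS FACTOR**: `(2⌊r⌋₊ + 1)^d`. [folklore] -/
def MρT (d : ℕ) (r : ℝ) : ℝ := ((2 : ℝ) * (⌊r⌋₊ : ℕ) + 1) ^ d

/-- the radius factor is nonnegative [folklore] -/
theorem MρT_nonneg (d : ℕ) (r : ℝ) : 0 ≤ MρT d r := by unfold MρT; positivity

/-- **`hNZle` ON THE TORUS**: `NZT d L r t s ≤ MρT d r · (L^d)^{t+1−s}` (`NTT_le`; `Λ := L^d`). [folklore] -/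
theorem NZT_le {L : ℕ} (hL : 1 ≤ L) (d : ℕ) (r : ℝ) (t s : ℕ) :
    (NZT d L r t s : ℝ) ≤ MρT d r * ((L : ℝ) ^ d) ^ (t + 1 - s) := by
  unfold NZT MρT
  exact_mod_cast NTT_le hL d ⌊r⌋₊ t s

/-- **THE EXPONENTIAL TYPE OF THE RADIUS FACTOR**: `MρT d r ≤ exp(0 + 2d·r)` for `r ≥ 0` (`2⌊r⌋₊ + 1 ≤ 2r + 1 ≤ e^{2r}`)
— the shape `HistoryJoinsRadius.MρP_le_exp_bsum` asks with `a := 0`, `d′ := 2d`. [folklore] -/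
theorem MρT_le_exp (d : ℕ) {r : ℝ} (hr : 0 ≤ r) : MρT d r ≤ Real.exp (0 + 2 * (d : ℝ) * r) := by
  unfold MρT
  have h1 : (2 : ℝ) * (⌊r⌋₊ : ℕ) + 1 ≤ Real.exp (2 * r) := by
    have hf : ((⌊r⌋₊ : ℕ) : ℝ) ≤ r := Nat.floor_le hr
    have := Real.add_one_le_exp (2 * r)
    linarith
  have h0 : (0 : ℝ) ≤ 2 * (⌊r⌋₊ : ℕ) + 1 := by positivity
  calc ((2 : ℝ) * (⌊r⌋₊ : ℕ) + 1) ^ d ≤ (Real.exp (2 * r)) ^ d := pow_le_pow_left₀ h0 h1 d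
    _ = Real.exp (0 + 2 * (d : ℝ) * r) := by rw [← Real.exp_nat_mul]; ring_nf

/-! ## §2 The same at levels -/

/-- **THE TORUS NEARNESS AT LEVELS AND A REAL RADIUS** (`touchD n L K lv k t u y s`). [folklore] -/
def nearD (n L K : ℕ) (lv : ℕ → ℕ) : (Fin d → ℕ) → ℕ → TCell d (n * L ^ K) → ℕ → ℝ → Prop :=
  nearOfNat fun k u t y s => touchD n L K lv k t u y s

/-- `nearD` is monotone in the radius [folklore] -/
theorem nearD_mono (n L K : ℕ) (lv : ℕ → ℕ) (u : Fin d → ℕ) (t : ℕ) (y : TCell d (n * L ^ K)) (s : ℕ) (r r' : ℝ)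
    (h : nearD n L K lv u t y s r) (hr : r ≤ r') : nearD n L K lv u t y s r' :=
  nearOfNat_mono _ u t y s r r' h hr

/-- touching at levels at integer radius `k` is being near at real radius `k` [folklore] -/
theorem nearD_of_touchD {n L K : ℕ} {lv : ℕ → ℕ} {k t : ℕ} {u : Fin d → ℕ} {y : TCell d (n * L ^ K)} {s : ℕ}
    (h : touchD n L K lv k t u y s) : nearD n L K lv u t y s (k : ℝ) :=
  nearOfNat_of_touch _ h

/-- **THE READING FACT `hnearW` AT LEVELS**: a block `u` in range at level `lv t ≤ K` is near a scale-`lv s` cell `y` at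
its own witness radius `cdist (n·L^{K − lv t}) u (blk L (lv t) y)`. [folklore] -/
theorem nearD_of_scale {n L K : ℕ} {lv : ℕ → ℕ} {t s : ℕ} {u : Fin d → ℕ} {y : TCell d (n * L ^ K)}
    (htK : lv t ≤ K) (hy : IsScale L (lv s) y) (hu : ∀ i, u i < n * L ^ (K - lv t)) :
    nearD n L K lv u t y s ((cdist (n * L ^ (K - lv t)) u (blk L (lv t) y) : ℕ) : ℝ) :=
  nearOfNat_of_touch _ (show touchD n L K lv _ t u y s from
    ⟨htK, hy, hu, fun i => (cdist_le_iff (u := u) (v := blk L (lv t) y)).1 le_rfl i⟩)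

/-- **THE ONE-BLOCK ROOT COUNT AT LEVELS**: `NTD` at the integer part of the radius. [folklore] -/
def NZD (d L : ℕ) (lv : ℕ → ℕ) (r : ℝ) (t s : ℕ) : ℕ := NTD d L lv ⌊r⌋₊ t s

/-- **`hNZ` AT LEVELS**: `#{y | nearD n L K lv u t y s r} ≤ NZD d L lv r t s` (`card_touchD_le`). [folklore] -/
theorem card_nearD_le (n : ℕ) {L : ℕ} (hL : 1 ≤ L) (K : ℕ) (lv : ℕ → ℕ) (u : Fin d → ℕ) (t s : ℕ) (r : ℝ) :
    ((univ : Finset (TCell d (n * L ^ K))).filter fun y => nearD n L K lv u t y s r).card ≤ NZD d L lv r t s :=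
  card_nearOfNat_le (fun k u t y s => touchD n L K lv k t u y s)
    (fun _ _ _ _ _ _ hk h => touchT_mono_radius hk h) (fun k t s => NTD d L lv k t s)
    (fun k u t s => card_touchD_le n hL K lv k t u s) u t s r

/-- **`hNZle` AT LEVELS**: for a level function, `NZD d L lv r t s ≤ MρT d r · (L^d)^{t+1−s}` (`NTD_le`). [folklore] -/
theorem NZD_le {K : ℕ} {lv : ℕ → ℕ} (h : LevelFn K lv) {L : ℕ} (hL : 1 ≤ L) (d : ℕ) (r : ℝ) (t s : ℕ) :
    (NZD d L lv r t s : ℝ) ≤ MρT d r * ((L : ℝ) ^ d) ^ (t + 1 - s) := by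
  unfold NZD MρT
  exact_mod_cast NTD_le h hL d ⌊r⌋₊ t s

end

end Summit.QuantumFields.BalabanUV.T4Continuum.HistoryJoinsSupTorus
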